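/-
Copyright (c) 2026 the pub-hodgecm-mathlib formalisation cell (harness21).  Prover seat hodgecm-mathlib-K2E3-p27 (g4), Track B «K2-LIT», h413 = `stmt-HodgeConjecture-24833`,
route `HCCMUnconditional`, R90-TF S8; deal S8-R240 (4) (S8 dealer R90-CS-plan (g3)): #4′ SCOUT + FIRST PAYMENT — the NONEMPTY-INDEX edition of the #4′ seam ★ p862226
`R90S8ResHTransportOfQuasiSplit` (H-side twin of ★ F3′ p863318 `R90S8ResGTransportOfQuasiSplitNonemptyU3`).
-/
import Summits.HodgeConjecture.HodgeConjecture.Theorems.R90S8ResHTransportOfQuasiSplit   -- ★ p862226 (K2E1-p15): `resH_le_closure_charLines_of_eq`, `resH_spannedByCharLines_of_quasiSplit`, the `subst` seam; brings ★ `R90S8ResidualDefs` (`charLine₂`), `cmParabolicDataR`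
import HarnessLib

/-!
# S8 #4′-road — `R90S8ResHTransportOfQuasiSplitNonemptyU2`: THE #4′ SEAM WITH THE QUASISPLIT HYPOTHESIS ASKED ONLY FOR NONEMPTY PARABOLIC INDEX

Track B ∕ K2-LIT, crux h413 = `stmt-HodgeConjecture-24833`, route of record `HCCMUnconditional`; cell `hodgecm-mathlib`, R90-TF S8 «ContSpec-n½», socket #4′
`sock_S8_resH_spannedByCharLines` (`Lines/R90_S8_ResidualSpectrumU3B.lean` ED. 7 :494–:503); S8 dealer R90-CS-plan (g3) deal S8-R240 (4); letter T1 of the #4′ LETTER LEDGER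
(`K2/K2E3-p27/g4/CENSUS-S8B-4prime-LetterLedger.K2E3-p27-g4.md` 5c173261db2228a3).  THEOREMS ONLY (no `def`, no `instance`, no `notation`, no named-fact hypothesis, no `sorry`;
default heartbeats); lane `--supports stmt-HodgeConjecture-24833 --as helper` (count-neutral).  CLOSES NO SOCKET.

WHY ([MoeglinWaldspurger1995, I.2.18]; [Langlands1976, §7]; harness hygiene — the (R)′ precedent S8-R137).  ★ p862226 `resH_spannedByCharLines_of_quasiSplit` takes the quasiSplit-side
statement `H` «every irreducible closed `P ≤ L²_res(U(J₂)_{L∕L⁺}, 𝔓)` lies in `closure ⨆_ψ ℂ·[ψ∘det]`» for EVERY parabolic-unipotent datum `𝔓` whose radicals are `N(𝔸)`, including data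
with EMPTY index `𝔓.ι = ∅` — but the H7 assembly ★ `resH_spannedByCharLines_of_letters_quasiSplit` (K2E1-p14 (g3)) and its (E_blk) ∕ (D) inputs are typed with the bridge binder
`(hne : Nonempty 𝔓.ι)` (at `𝔓.ι = ∅` the family of constant-term conditions is empty, `L²_cusp` is all of `L²` in the model and `residualSubspace … 𝔓 = ⊥`, a case nobody needs).  The
repair of record is the (R)′ shape: quantify `H` additionally over `(hne : Nonempty 𝔓.ι)`.  This file is the matching seam: **`resH_le_closure_charLines_of_eq_of_nonempty`** (the
`J`-generic transport, `subst` device of ★ p862226 §1 verbatim) and **`resH_spannedByCharLines_of_quasiSplit_of_nonempty`** — SAME CONCLUSION BYTES as ★ p862226 §2 (= socket #4′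
:495–:502 verbatim: literal `Φ₂`, `cmResidualSubspaceR L 2`, `charLine₂`, `DiscreteAutomorphicRep`), because the record datum `cmParabolicDataR L 2` has index
`{k ∕∕ 1 ≤ k ∧ 2k ≤ 2} = {1}`, nonempty by the witness `⟨1, _⟩`.  B's eventual payment of #4′ is then the one-liner
`exact resH_spannedByCharLines_of_quasiSplit_of_nonempty (fun L _ _ _ μ _ 𝔓 h𝔓 hne P hP hPres => ‹letter-free H7 at (L, μ, 𝔓, hne, h𝔓, P)›)` with no empty-index case and no
in-socket transport.
* §1 **`resH_le_closure_charLines_of_eq_of_nonempty`** — Step 1 (`J`-generic, `subst`), `H` asked at nonempty index only.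
* §2 **`resH_spannedByCharLines_of_quasiSplit_of_nonempty`** — THE JUNCTION: (quasiSplit statement at nonempty index, ∀ CM field) → #4′'s exact type.
HONEST LABEL: HC_CM is proved only modulo the 7 printed citations (2 remaining named inputs: hLiu418 = `stmt-HodgeConjecture-24832`, h413 = `stmt-HodgeConjecture-24833`) until rung 0
closes; this file asserts no named fact, closes no socket (#4′ stays OPEN modulo the block-model family below `K_max` and the top-row letters), and is count-neutral; the quasiSplit-side
statement stays an explicit ∀-hypothesis.

## References
* [MoeglinWaldspurger1995] C. Mœglin, J.-L. Waldspurger, *Spectral Decomposition and Eisenstein Series* (1995), I.2.18, V.3.13.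
* [Langlands1976] R. P. Langlands, *On the Functional Equations Satisfied by Eisenstein Series*, SLN 544 (1976), §7.
* [Rogawski1990] J. D. Rogawski, *Automorphic Representations of Unitary Groups in Three Variables*, Ann. of Math. Stud. 123 (1990), §13.9 p. 229.
-/

set_option autoImplicit false
-- the mandated namespace repeats the single-problem summit's segment (`HodgeConjecture.HodgeConjecture`)
set_option linter.dupNamespace false

noncomputable section

open MeasureTheory NumberField IsDedekindDomain
open Literature.NumberTheory.GaloisRepresentations
open Literature.NumberTheory.Automorphic.Arthur2013.Leaves.TECR
open Literature.NumberTheory.Automorphic Literature.NumberTheory.Automorphic.UnitaryGroup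
open Summit.HodgeConjecture.HodgeConjecture.Cruxes.H413.K2E1CuspidalSpectrumUnitary
open Summit.HodgeConjecture.HodgeConjecture.Cruxes.H413.R90S8ResidualDefs (charLine₂)
open Summit.HodgeConjecture.HodgeConjecture.Cruxes.H413.K2E1SiegelRadicalCocompactU2 (upperUnitriangular_eq_standardUnipotentRadical_two)

namespace Summit.HodgeConjecture.HodgeConjecture.R90.S8

/-! ## §1 Step 1 at nonempty index: any form `J` equal to the antidiagonal one (`subst`) -/

/-- **Step 1 of the #4′ seam, NONEMPTY-INDEX EDITION**: ★ `resH_le_closure_charLines_of_eq` with the quasiSplit-side hypothesis `H` quantified ADDITIONALLY over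
`(hne : Nonempty 𝔓.ι)` (right after the radical clause — the (R)′ shape of S8-R137: at `𝔓.ι = ∅` an empty family of constant-term conditions makes `L²_cusp` everything and
`residualSubspace … 𝔓 = ⊥` in the model, so the honest statement is asked only for nonempty index, which is also the shape of the H7 assembly's bridge binder), and the matching outer
binder `hne`; transported to `U(J)` for any `J` with `(antidiagonal 2).over L = J` and radicals written `J`-generically as the pull-back of the standard `(1,1)` unipotent radical, by
`subst` and ★ `upperUnitriangular_eq_standardUnipotentRadical_two` exactly as in ★ p862226 §1. [cite: MoeglinWaldspurger1995, I.2.18] [cite: Langlands1976, §7] -/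
theorem resH_le_closure_charLines_of_eq_of_nonempty {L : Type} [Field L] [NumberField L] [IsCMField L]
    (H : ∀ (μ : Measure (quasiSplit (↥(maximalRealSubfield L)) L (IsCMField.complexConj L) 2).automorphicQuotient)
      [(quasiSplit (↥(maximalRealSubfield L)) L (IsCMField.complexConj L) 2).IsAutomorphicMeasure μ]
      (𝔓 : (quasiSplit (↥(maximalRealSubfield L)) L (IsCMField.complexConj L) 2).ParabolicUnipotentData)
      (_ : ∀ j : 𝔓.ι, 𝔓.radical j = adelicUnipotent (↥(maximalRealSubfield L)) L (IsCMField.complexConj L) 2) (_ : Nonempty 𝔓.ι)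
      (P : ContRepresentation.ClosedSubrep ((quasiSplit (↥(maximalRealSubfield L)) L (IsCMField.complexConj L) 2).rightRegular μ)),
      P.toContRep.IsTopIrreducible → P ≤ residualSubspace (quasiSplit (↥(maximalRealSubfield L)) L (IsCMField.complexConj L) 2) μ 𝔓 →
      P.toSubmodule ≤ (⨆ ψ : {ψ : ↥(TorusDict.torus (IsCMField.complexConj L)) →ₜ* ℂˣ // TorusDict.IsAutomorphic (IsCMField.complexConj L) ψ},
          (AdelicGroupData.AutomorphicCharacter.lineSubrep (𝒢 := (quasiSplit (↥(maximalRealSubfield L)) L (IsCMField.complexConj L) 2))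
            (cmDetChar L 2 ((StdForm.antidiagonal 2).over L) ψ.1 ψ.2 ((Matrix.isUnit_iff_isUnit_det _).mp (StdForm.isUnit_over (StdForm.antidiagonal 2) L)).ne_zero) μ).toSubmodule).topologicalClosure)
    {J : Matrix (Fin 2) (Fin 2) L} (hJ : (StdForm.antidiagonal 2).over L = J) (hJd : J.det ≠ 0)
    (μ : Measure (adelicGroupData (↥(maximalRealSubfield L)) L (IsCMField.complexConj L) 2 J).automorphicQuotient)
    [(adelicGroupData (↥(maximalRealSubfield L)) L (IsCMField.complexConj L) 2 J).IsAutomorphicMeasure μ]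
    (𝔓 : (adelicGroupData (↥(maximalRealSubfield L)) L (IsCMField.complexConj L) 2 J).ParabolicUnipotentData)
    (h𝔓 : ∀ j : 𝔓.ι, 𝔓.radical j = (standardUnipotentRadical 2 1 (AdeleRing (𝓞 L) L)).comap (adelicVal (↥(maximalRealSubfield L)) L (IsCMField.complexConj L) 2 J))
    (hne : Nonempty 𝔓.ι)
    (P : ContRepresentation.ClosedSubrep ((adelicGroupData (↥(maximalRealSubfield L)) L (IsCMField.complexConj L) 2 J).rightRegular μ))
    (hP : P.toContRep.IsTopIrreducible) (hPres : P ≤ residualSubspace (adelicGroupData (↥(maximalRealSubfield L)) L (IsCMField.complexConj L) 2 J) μ 𝔓) :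
    P.toSubmodule ≤ (⨆ ψ : {ψ : ↥(TorusDict.torus (IsCMField.complexConj L)) →ₜ* ℂˣ // TorusDict.IsAutomorphic (IsCMField.complexConj L) ψ},
        (AdelicGroupData.AutomorphicCharacter.lineSubrep (𝒢 := (adelicGroupData (↥(maximalRealSubfield L)) L (IsCMField.complexConj L) 2 J))
          (cmDetChar L 2 J ψ.1 ψ.2 hJd) μ).toSubmodule).topologicalClosure := by
  subst hJ
  have h𝔓' : ∀ j : 𝔓.ι, 𝔓.radical j = adelicUnipotent (↥(maximalRealSubfield L)) L (IsCMField.complexConj L) 2 := fun j => by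
    rw [h𝔓 j]
    show _ = (upperUnitriangular (Fin 2) (AdeleRing (𝓞 L) L)).comap _
    rw [upperUnitriangular_eq_standardUnipotentRadical_two]
  exact H μ 𝔓 h𝔓' hne P hP hPres

/-! ## §2 Step 2 at nonempty index: the junction to #4′'s frozen bytes -/

/-- **THE JUNCTION FOR #4′, NONEMPTY-INDEX EDITION — the quasiSplit statement at nonempty parabolic index, for every CM field, yields socket #4′'s EXACT type**
(`Lines/R90_S8_ResidualSpectrumU3B.lean` ED. 7 :495–:502: literal `Φ₂`, `cmResidualSubspaceR`, `charLine₂`, `DiscreteAutomorphicRep` — the same conclusion bytes as ★ p862226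
`resH_spannedByCharLines_of_quasiSplit`): §1 at `J := Φ₂` (★ `antidiagOne_eq_over`, ★ `isUnit_antidiagOne_det`), `𝔓 := cmParabolicDataR L 2` (single radical
`cmUnipotentRadicalR L 2 1 = standardUnipotentRadical 2 1`, ★ `cmUnipotentRadicalR_of_two_mul_eq`; its index `{k ∕∕ 1 ≤ k ∧ 2k ≤ 2}` is inhabited by `⟨1, _⟩` — the ONE new token),
instance ascription `cmDatum → adelicGroupData`, `P.space ∕ P.irreducible`.  B pays #4′ by `exact resH_spannedByCharLines_of_quasiSplit_of_nonempty ‹letter-free H7 (with its bridge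
binder `hne`)›`.  Shapes and proof: ★ p862226 §2 (R90-CS-audit1 (g2)'s kernel cert fdbdce6a64ce2a74) with the one extra binder. [cite: MoeglinWaldspurger1995, I.2.18] [cite: Langlands1976, §7] -/
theorem resH_spannedByCharLines_of_quasiSplit_of_nonempty
    (H : ∀ (L : Type) [Field L] [NumberField L] [IsCMField L]
      (μ : Measure (quasiSplit (↥(maximalRealSubfield L)) L (IsCMField.complexConj L) 2).automorphicQuotient)
      [(quasiSplit (↥(maximalRealSubfield L)) L (IsCMField.complexConj L) 2).IsAutomorphicMeasure μ]
      (𝔓 : (quasiSplit (↥(maximalRealSubfield L)) L (IsCMField.complexConj L) 2).ParabolicUnipotentData)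
      (_ : ∀ j : 𝔓.ι, 𝔓.radical j = adelicUnipotent (↥(maximalRealSubfield L)) L (IsCMField.complexConj L) 2) (_ : Nonempty 𝔓.ι)
      (P : ContRepresentation.ClosedSubrep ((quasiSplit (↥(maximalRealSubfield L)) L (IsCMField.complexConj L) 2).rightRegular μ)),
      P.toContRep.IsTopIrreducible → P ≤ residualSubspace (quasiSplit (↥(maximalRealSubfield L)) L (IsCMField.complexConj L) 2) μ 𝔓 →
      P.toSubmodule ≤ (⨆ ψ : {ψ : ↥(TorusDict.torus (IsCMField.complexConj L)) →ₜ* ℂˣ // TorusDict.IsAutomorphic (IsCMField.complexConj L) ψ},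
          (AdelicGroupData.AutomorphicCharacter.lineSubrep (𝒢 := (quasiSplit (↥(maximalRealSubfield L)) L (IsCMField.complexConj L) 2))
            (cmDetChar L 2 ((StdForm.antidiagonal 2).over L) ψ.1 ψ.2 ((Matrix.isUnit_iff_isUnit_det _).mp (StdForm.isUnit_over (StdForm.antidiagonal 2) L)).ne_zero) μ).toSubmodule).topologicalClosure) :
    ∀ (L : Type) [Field L] [NumberField L] [IsCMField L]
      (μ₂ : Measure (UnitaryGroup.cmDatum L 2 (Matrix.of fun i j : Fin 2 => if i.val + j.val + 1 = 2 then (1 : L) else 0)).automorphicQuotient)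
      [(UnitaryGroup.cmDatum L 2 (Matrix.of fun i j : Fin 2 => if i.val + j.val + 1 = 2 then (1 : L) else 0)).IsAutomorphicMeasure μ₂]
      (P : DiscreteAutomorphicRep (UnitaryGroup.cmDatum L 2 (Matrix.of fun i j : Fin 2 => if i.val + j.val + 1 = 2 then (1 : L) else 0)) μ₂),
      P.space ≤ cmResidualSubspaceR L 2 μ₂ →
      P.space.toSubmodule ≤
        (⨆ ψ : {ψ : ↥(TorusDict.torus (IsCMField.complexConj L)) →ₜ* ℂˣ // TorusDict.IsAutomorphic (IsCMField.complexConj L) ψ},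
            (charLine₂ L ψ.1 ψ.2 μ₂).toSubmodule).topologicalClosure := by
  intro L _ _ _ μ₂ _ P hP
  haveI : (adelicGroupData (↥(maximalRealSubfield L)) L (IsCMField.complexConj L) 2
      (Matrix.of fun i j : Fin 2 => if i.val + j.val + 1 = 2 then (1 : L) else 0)).IsAutomorphicMeasure μ₂ :=
    ‹(UnitaryGroup.cmDatum L 2 (Matrix.of fun i j : Fin 2 => if i.val + j.val + 1 = 2 then (1 : L) else 0)).IsAutomorphicMeasure μ₂›
  have hrad : ∀ j : (cmParabolicDataR L 2).ι, (cmParabolicDataR L 2).radical j =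
      (standardUnipotentRadical 2 1 (AdeleRing (𝓞 L) L)).comap
        (adelicVal (↥(maximalRealSubfield L)) L (IsCMField.complexConj L) 2 (Matrix.of fun i j : Fin 2 => if i.val + j.val + 1 = 2 then (1 : L) else 0)) := by
    rintro ⟨k, hk1, hk2⟩
    have hk : k = 1 := by omega
    subst hk
    show cmUnipotentRadicalR L 2 1 = _
    rw [cmUnipotentRadicalR_of_two_mul_eq L 2 1 rfl]
    rfl
  -- the ONE new token: the record datum's index `{k ∕∕ 1 ≤ k ∧ 2k ≤ 2} = {1}` is inhabited
  have hne : Nonempty (cmParabolicDataR L 2).ι := ⟨⟨1, le_rfl, le_rfl⟩⟩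
  exact resH_le_closure_charLines_of_eq_of_nonempty (H L) (antidiagOne_eq_over L 2).symm (isUnit_antidiagOne_det L 2).ne_zero μ₂ (cmParabolicDataR L 2) hrad hne
    P.space P.irreducible hP

end Summit.HodgeConjecture.HodgeConjecture.R90.S8

end
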